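import Summits.QuantumFields.BalabanUV.Beta.D1BFx.LiteralStencilSockets
import Summits.QuantumFields.BalabanUV.Beta.CombTablesAn1
import Summits.QuantumFields.BalabanUV.Beta.SpineRecursiveParity

/-!
# `BalabanUV.Beta.D1BFx.RoadCombPinAn1` — road «BF-x» for binder row D1 under RULING R-D1-g55-1 (RE-TABLE FINAL; `HOME/b2b-balaban-beta-d1-p2/RETABLE-SPEC-g28.md` §2):
# **THE [S] SOCKETS OF THE RE-TABLED PIN, DISCHARGED** — the comb twin of `RoadHybPinAn1`.  PART 22's binder
# `S : ℕ → Fin 4 → (Fin 4 → ℤ) → MKer 4 (Fib 3)` (`RoadEndBFxRoadScalesJ1RowS` ∕ `…J1RFlatS`) is pinned, for the RE-TABLED road, to the odd-indexed RAW chart-(III′)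
# member over an2's COMB table record `CombTablesAn1.combTablesAn1S2` (the road keeps its comb slice `G₀` and carries the comb scheme's WHOLE table record):
#   `S n := if h : Odd n then (JsB12CombSh0 (Lc := n) h N (combTablesAn1S2 n h (cΛ (Nat.log Lc n))) (cΛ (Nat.log Lc n)) (cB (Nat.log Lc n)) 0).S else 0`
# (at `n = Lc^m`: the raw member over `combTablesAn1S2 (Lc^m) hLc.pow (cΛ m)` — `S_at_pow`).  This file proves, in PART 22's EXACT binder shapes, the seven
# structural sockets `hScovB ∕ hSmm ∕ hSfm ∕ hSff ∕ hS ∕ hCs ∕ hδS` of that pin, BY NAME from leaf-01's TABLE-GENERIC raw-literal letters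
# (`LiteralStencilSockets` §3: `JsB12CombSh0_S_covB`, `JsB12CombSh0_S_inr_inr`, `trK_JsB12CombSh0_S` + `fm_eq_of_parityOdd ∕ ff_eq_of_parityOdd`, the `pin_*`
# wrappers) fed the COMB record's four table facts (§0: (V-mm) `packVH_inr_inr`, (H-mm) `hessFFAt_inr`, (V-p) `trK_vhSAt`, (H-p) `trK_hessFFAt` — all in the tree)
# and the datum's own `JetData.loc ∕ δ_pos`.  Nothing of the [M] rows, of (J1) (`hC₁`), of (J2) or of [W] is touched; the literal `Jc`, `Js`, ROOT M‴ unchanged.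

HONEST DEPENDENCY (cell records, verbatim): «continuum YM on T⁴ ⇐ BetaPertH ∧ nine spine estimates (0/9 proved); BetaPertH ⇐ (D1) ∧ (D4) ∧
CAP+tail; G-an2-4 gates asym, D1 and NE2/3/4.»  HONEST FRAMING (cell contract, verbatim): «discharging `BetaPertH` makes Bałaban's UV stability
UNCONDITIONAL — a real constructive-QFT result; it is NOT the continuum limit and NOT the Clay problem.»  THIS MODULE DISCHARGES NOTHING of (J1),
of (K), of D1 or of the wall: [folklore] `dif_pos ∕ dif_neg` bookkeeping over leaf-01's table-generic letters at the comb record.  No definition, no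
`def … : Prop`, nothing cited, 0 sorry.  0∕4 row-D1 binders (hW ∕ hR ∕ D1Tel ∕ D1Rep); (K) NOT closed; (J1) ONE OPEN ROW (direction RE-TABLE FINAL, viability (B)
pending by value); NOT D1, NEVER «G-an2-4 closed», NOT `BetaPertH`, NOT continuum, NOT Clay.

ABSOLUTE RULE (cell charter, verbatim): «No internally-minted statement may enter as a cited fact. Every hypothesis is either kernel-proved in this
package or a verbatim quotation of a PUBLISHED theorem with page reference. The manuscript(s) under audit are NOT citable for their own disputed
steps — they are the thing under adjudication; programme-internal (2001/route/tribunal) claims are never citable.»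

CONTENT (all [folklore]): §0 `combTablesAn1S2_V_inr_inr`, `combTablesAn1S2_H_inr_inr`, `trK_JsB12CombSh0_S_comb`; §1 `S_at_odd`, `S_at_pow`; §2 `S_covB`
(`hScovB`), `S_inr_inr` (`hSmm`), `S_inl_inr` (`hSfm`), `S_inl_inl` (`hSff`); §3 `S_locStencil` (`hS`), `Cs_nonneg` (`hCs`), `δ_pos` (`hδS`).
Unit `b2b-balaban-beta-d1-p2` (road owner, gen 28), 2026-08-25; no existing file touched.
-/

noncomputable section

namespace Summit.QuantumFields.BalabanUV.Beta.D1BFx.RoadCombPinAn1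

open Literature.MathematicalPhysics.QuantumFieldTheory.Balaban1983to89
open Literature.MathematicalPhysics.QuantumFieldTheory.Balaban1983to89.Beta
open ExpKernelCalculus (MKer shiftK)
open OneStepResolventKernel (Fib JetData LocStencil)
open Summit.QuantumFields.BalabanUV.Beta.CombTablesAn1 (combTablesAn1S2 combTablesAn1S2_V combTablesAn1S2_H)
open Summit.QuantumFields.BalabanUV.Beta.TameKernelCalculus (trK)
open Summit.QuantumFields.BalabanUV.Beta.BorderedHessian (sgnK)
open Summit.QuantumFields.BalabanUV.Beta.D1BFx.DressingParityTransport (fm_eq_of_parityOdd ff_eq_of_parityOdd)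
open Summit.QuantumFields.BalabanUV.Beta.SpineRecursiveParity (trK_vhSAt trK_hessFFAt)
open AveragingHessianKernelsRooted (vhSAt hessFFAt hessFFAt_inr)
open Summit.QuantumFields.BalabanUV.Beta.CombChartStepJets (JsB12CombSh0)
open Summit.QuantumFields.BalabanUV.Beta.D1BFx.LiteralStencilSockets


/-! ## §0 The comb record's table facts (V-mm)(H-mm)(V-p)(H-p) and the comb member's row parity (table-generic letters of `LiteralStencilSockets` §3) -/

section CombFacts

variable {n : ℕ} [NeZero n]

omit [NeZero n] in
/-- [folklore] (V-mm) AT THE COMB RECORD: `vhSAt ρ_c` is packed by `packVH`, which has no mm block. -/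
theorem combTablesAn1S2_V_inr_inr (hn : Odd n) (cΛ' : ℝ) (κ : Fin 4) (u x y : Fin 4 → ℤ) (m m' : Fin 4) :
    (combTablesAn1S2 n hn cΛ').V κ u x y (Sum.inr m) (Sum.inr m') = 0 := by
  rw [combTablesAn1S2_V]
  unfold vhSAt
  rw [AveragingHessianKernels.packVH_inr_inr]

omit [NeZero n] in
/-- [folklore] (H-mm) AT THE COMB RECORD: `hessFFAt ρ_c` lives on the field–field block (`hessFFAt_inr`). -/
theorem combTablesAn1S2_H_inr_inr (hn : Odd n) (cΛ' : ℝ) (μ : Fin 4) (w x y : Fin 4 → ℤ) (m m' : Fin 4) :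
    (combTablesAn1S2 n hn cΛ').H μ w x y (Sum.inr m) (Sum.inr m') = 0 := by
  rw [combTablesAn1S2_H, hessFFAt_inr]

/-- [folklore] **THE RAW COMB MEMBER IS ROW-PARITY-ODD AT EVERY LEVEL** ((V-p)(H-p) at the comb record: an2's `trK_vhSAt`, `trK_hessFFAt`, fed to leaf-01's
table-generic `trK_JsB12CombSh0_S`). -/
theorem trK_JsB12CombSh0_S_comb (hn : Odd n) (N : ℕ) (cΛ' cB' : ℝ) (j : ℕ) (κ : Fin 4) (u : Fin 4 → ℤ) :
    trK ((JsB12CombSh0 hn N (combTablesAn1S2 n hn cΛ') cΛ' cB' j).S κ u) = -sgnK ((JsB12CombSh0 hn N (combTablesAn1S2 n hn cΛ') cΛ' cB' j).S κ u) :=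
  trK_JsB12CombSh0_S hn N _ cΛ' cB' (fun κ' u' => by rw [combTablesAn1S2_V]; exact trK_vhSAt _ _ κ' u')
    (fun μ y => by rw [combTablesAn1S2_H]; exact trK_hessFFAt _ _ μ y) j κ u

end CombFacts

variable (Lc : ℕ) (N : ℕ) (cΛ cB : ℕ → ℝ)

/-! ## §1 The pin read at odd blockings and at the scales -/

/-- [folklore] At an odd blocking the comb pin IS the raw comb member's first-derivative family. -/
theorem S_at_odd {n : ℕ} (hn : Odd n) :
    (fun n : ℕ => if h : Odd n then (haveI : NeZero n := ⟨h.pos.ne'⟩;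
        (JsB12CombSh0 (Lc := n) h N (combTablesAn1S2 n h (cΛ (Nat.log Lc n))) (cΛ (Nat.log Lc n)) (cB (Nat.log Lc n)) 0).S) else 0) n
      = (haveI : NeZero n := ⟨hn.pos.ne'⟩;
        (JsB12CombSh0 (Lc := n) hn N (combTablesAn1S2 n hn (cΛ (Nat.log Lc n))) (cΛ (Nat.log Lc n)) (cB (Nat.log Lc n)) 0).S) := by
  simp only [dif_pos hn]

/-- [folklore] **THE PIN AT THE SCALES**: at `n = Lc^m` (`Lc` odd, `1 < Lc`) the pin IS the raw member of the RE-TABLED road's first-order family at blocking `Lc^m`: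
the raw chart-(III′) member over the COMB record `combTablesAn1S2 (Lc^m) hLc.pow (cΛ m)` with the locks `cΛ m ∕ cB m` (`Nat.log_pow`). -/
theorem S_at_pow [NeZero Lc] (hLc : Odd Lc) (hL : 1 < Lc) (m : ℕ) :
    (fun n : ℕ => if h : Odd n then (haveI : NeZero n := ⟨h.pos.ne'⟩;
        (JsB12CombSh0 (Lc := n) h N (combTablesAn1S2 n h (cΛ (Nat.log Lc n))) (cΛ (Nat.log Lc n)) (cB (Nat.log Lc n)) 0).S) else 0) (Lc ^ m)
      = (JsB12CombSh0 (Lc := Lc ^ m) hLc.pow N (combTablesAn1S2 (Lc ^ m) hLc.pow (cΛ m)) (cΛ m) (cB m) 0).S := by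
  have h : Odd (Lc ^ m) := hLc.pow
  simp only [dif_pos h, Nat.log_pow hL]

/-! ## §2 The four entry sockets `hScovB ∕ hSmm ∕ hSfm ∕ hSff` -/

/-- [folklore] **`hScovB` OF THE COMB PIN**: block covariance at every blocking (odd: leaf-01's table-generic `JsB12CombSh0_S_covB`; even: the zero family). -/
theorem S_covB (n : ℕ) (κ : Fin 4) (u t : Fin 4 → ℤ) :
    (fun n : ℕ => if h : Odd n then (haveI : NeZero n := ⟨h.pos.ne'⟩;
        (JsB12CombSh0 (Lc := n) h N (combTablesAn1S2 n h (cΛ (Nat.log Lc n))) (cΛ (Nat.log Lc n)) (cB (Nat.log Lc n)) 0).S) else 0) n κ (u + ((n : ℕ) : ℤ) • t)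
      = shiftK (-(((n : ℕ) : ℤ) • t)) ((fun n : ℕ => if h : Odd n then (haveI : NeZero n := ⟨h.pos.ne'⟩;
        (JsB12CombSh0 (Lc := n) h N (combTablesAn1S2 n h (cΛ (Nat.log Lc n))) (cΛ (Nat.log Lc n)) (cB (Nat.log Lc n)) 0).S) else 0) n κ u) :=
  pin_covB (fun n h => (haveI : NeZero n := ⟨h.pos.ne'⟩;
        (JsB12CombSh0 (Lc := n) h N (combTablesAn1S2 n h (cΛ (Nat.log Lc n))) (cΛ (Nat.log Lc n)) (cB (Nat.log Lc n)) 0).S))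
    (fun n h κ u t => by
    haveI : NeZero n := ⟨h.pos.ne'⟩
    exact JsB12CombSh0_S_covB h N _ _ _ 0 κ u t) n κ u t

/-- [folklore] **`hSmm` OF THE COMB PIN**: the multiplier–multiplier block vanishes (leaf-01's table-generic `JsB12CombSh0_S_inr_inr` fed (V-mm)(H-mm) of the comb record, §0). -/
theorem S_inr_inr (n : ℕ) (κ : Fin 4) (u x y : Fin 4 → ℤ) (c b : Fin 4) :
    (fun n : ℕ => if h : Odd n then (haveI : NeZero n := ⟨h.pos.ne'⟩;
        (JsB12CombSh0 (Lc := n) h N (combTablesAn1S2 n h (cΛ (Nat.log Lc n))) (cΛ (Nat.log Lc n)) (cB (Nat.log Lc n)) 0).S) else 0) n κ u x y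
        (Sum.inr c) (Sum.inr b) = 0 :=
  pin_entry_zero (fun n h => (haveI : NeZero n := ⟨h.pos.ne'⟩;
        (JsB12CombSh0 (Lc := n) h N (combTablesAn1S2 n h (cΛ (Nat.log Lc n))) (cΛ (Nat.log Lc n)) (cB (Nat.log Lc n)) 0).S))
    (Sum.inr c) (Sum.inr b) (fun n h κ u x y => by
    haveI : NeZero n := ⟨h.pos.ne'⟩
    exact JsB12CombSh0_S_inr_inr h N _ _ _ (combTablesAn1S2_V_inr_inr h _) (combTablesAn1S2_H_inr_inr h _) 0 κ u x y c b) n κ u x y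

/-- [folklore] **`hSfm` OF THE COMB PIN** (row parity of the comb member, §0): `S n κ u x y (inl c) (inr b) = S n κ u y x (inr b) (inl c)`. -/
theorem S_inl_inr (n : ℕ) (κ : Fin 4) (u x y : Fin 4 → ℤ) (c b : Fin 4) :
    (fun n : ℕ => if h : Odd n then (haveI : NeZero n := ⟨h.pos.ne'⟩;
        (JsB12CombSh0 (Lc := n) h N (combTablesAn1S2 n h (cΛ (Nat.log Lc n))) (cΛ (Nat.log Lc n)) (cB (Nat.log Lc n)) 0).S) else 0) n κ u x y
        (Sum.inl c) (Sum.inr b)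
      = (fun n : ℕ => if h : Odd n then (haveI : NeZero n := ⟨h.pos.ne'⟩;
        (JsB12CombSh0 (Lc := n) h N (combTablesAn1S2 n h (cΛ (Nat.log Lc n))) (cΛ (Nat.log Lc n)) (cB (Nat.log Lc n)) 0).S) else 0) n κ u y x
        (Sum.inr b) (Sum.inl c) := by
  have h := pin_entry (fun n h => (haveI : NeZero n := ⟨h.pos.ne'⟩;
        (JsB12CombSh0 (Lc := n) h N (combTablesAn1S2 n h (cΛ (Nat.log Lc n))) (cΛ (Nat.log Lc n)) (cB (Nat.log Lc n)) 0).S))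
    1 (Sum.inl c) (Sum.inr b) (Sum.inl c) (Sum.inr b) (fun n h κ u x y => by
    haveI : NeZero n := ⟨h.pos.ne'⟩
    rw [one_mul]
    exact fm_eq_of_parityOdd (trK_JsB12CombSh0_S_comb h N _ _ 0 κ u) x y c b) n κ u x y
  rw [one_mul] at h
  exact h

/-- [folklore] **`hSff` OF THE COMB PIN** (row parity of the comb member, §0): `S n κ u x y (inl c) (inl b) = −S n κ u y x (inl b) (inl c)`. -/
theorem S_inl_inl (n : ℕ) (κ : Fin 4) (u x y : Fin 4 → ℤ) (c b : Fin 4) :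
    (fun n : ℕ => if h : Odd n then (haveI : NeZero n := ⟨h.pos.ne'⟩;
        (JsB12CombSh0 (Lc := n) h N (combTablesAn1S2 n h (cΛ (Nat.log Lc n))) (cΛ (Nat.log Lc n)) (cB (Nat.log Lc n)) 0).S) else 0) n κ u x y
        (Sum.inl c) (Sum.inl b)
      = -(fun n : ℕ => if h : Odd n then (haveI : NeZero n := ⟨h.pos.ne'⟩;
        (JsB12CombSh0 (Lc := n) h N (combTablesAn1S2 n h (cΛ (Nat.log Lc n))) (cΛ (Nat.log Lc n)) (cB (Nat.log Lc n)) 0).S) else 0) n κ u y x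
        (Sum.inl b) (Sum.inl c) := by
  have h := pin_entry (fun n h => (haveI : NeZero n := ⟨h.pos.ne'⟩;
        (JsB12CombSh0 (Lc := n) h N (combTablesAn1S2 n h (cΛ (Nat.log Lc n))) (cΛ (Nat.log Lc n)) (cB (Nat.log Lc n)) 0).S))
    (-1) (Sum.inl c) (Sum.inl b) (Sum.inl c) (Sum.inl b) (fun n h κ u x y => by
    haveI : NeZero n := ⟨h.pos.ne'⟩
    rw [neg_one_mul]
    exact ff_eq_of_parityOdd (trK_JsB12CombSh0_S_comb h N _ _ 0 κ u) x y c b) n κ u x y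
  rw [neg_one_mul] at h
  exact h

/-! ## §3 Locality with the pinned constants (`hS ∕ hCs ∕ hδS`) -/

/-- [folklore] **`hS` OF THE COMB PIN**: `LocStencil (S n) (Cs n) (δS n)` with the PINNED constants
`Cs n := if h : Odd n then (the raw member).Cs else 0`, `δS n := if h : Odd n then (the raw member).δ else 1` (the datum's own `JetData.loc`). -/
theorem S_locStencil (n : ℕ) :
    LocStencil
      ((fun n : ℕ => if h : Odd n then (haveI : NeZero n := ⟨h.pos.ne'⟩;
        (JsB12CombSh0 (Lc := n) h N (combTablesAn1S2 n h (cΛ (Nat.log Lc n))) (cΛ (Nat.log Lc n)) (cB (Nat.log Lc n)) 0).S) else 0) n)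
      ((fun n : ℕ => if h : Odd n then (haveI : NeZero n := ⟨h.pos.ne'⟩;
        (JsB12CombSh0 (Lc := n) h N (combTablesAn1S2 n h (cΛ (Nat.log Lc n))) (cΛ (Nat.log Lc n)) (cB (Nat.log Lc n)) 0).Cs) else 0) n)
      ((fun n : ℕ => if h : Odd n then (haveI : NeZero n := ⟨h.pos.ne'⟩;
        (JsB12CombSh0 (Lc := n) h N (combTablesAn1S2 n h (cΛ (Nat.log Lc n))) (cΛ (Nat.log Lc n)) (cB (Nat.log Lc n)) 0).δ) else 1) n) :=
  pin_locStencil (fun n h => (haveI : NeZero n := ⟨h.pos.ne'⟩;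
        (JsB12CombSh0 (Lc := n) h N (combTablesAn1S2 n h (cΛ (Nat.log Lc n))) (cΛ (Nat.log Lc n)) (cB (Nat.log Lc n)) 0).S))
    (fun n h => (haveI : NeZero n := ⟨h.pos.ne'⟩;
        (JsB12CombSh0 (Lc := n) h N (combTablesAn1S2 n h (cΛ (Nat.log Lc n))) (cΛ (Nat.log Lc n)) (cB (Nat.log Lc n)) 0).Cs))
    (fun n h => (haveI : NeZero n := ⟨h.pos.ne'⟩;
        (JsB12CombSh0 (Lc := n) h N (combTablesAn1S2 n h (cΛ (Nat.log Lc n))) (cΛ (Nat.log Lc n)) (cB (Nat.log Lc n)) 0).δ))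
    (fun n h => by
    haveI : NeZero n := ⟨h.pos.ne'⟩
    exact (JsB12CombSh0 (Lc := n) h N (combTablesAn1S2 n h (cΛ (Nat.log Lc n))) (cΛ (Nat.log Lc n)) (cB (Nat.log Lc n)) 0).loc) n

/-- [folklore] **`hCs` OF THE COMB PIN**: the pinned constants are nonnegative (`JetData.loc` at one entry, `BiLoc.nonneg`). -/
theorem Cs_nonneg (n : ℕ) :
    0 ≤ (fun n : ℕ => if h : Odd n then (haveI : NeZero n := ⟨h.pos.ne'⟩;
        (JsB12CombSh0 (Lc := n) h N (combTablesAn1S2 n h (cΛ (Nat.log Lc n))) (cΛ (Nat.log Lc n)) (cB (Nat.log Lc n)) 0).Cs) else 0) n :=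
  pin_Cs_nonneg (fun n h => (haveI : NeZero n := ⟨h.pos.ne'⟩;
        (JsB12CombSh0 (Lc := n) h N (combTablesAn1S2 n h (cΛ (Nat.log Lc n))) (cΛ (Nat.log Lc n)) (cB (Nat.log Lc n)) 0).Cs))
    (fun n h => by
    haveI : NeZero n := ⟨h.pos.ne'⟩
    exact ((JsB12CombSh0 (Lc := n) h N (combTablesAn1S2 n h (cΛ (Nat.log Lc n))) (cΛ (Nat.log Lc n)) (cB (Nat.log Lc n)) 0).loc 0 0).nonneg
      (Sum.inl 0)) n

/-- [folklore] **`hδS` OF THE COMB PIN**: the pinned rates are positive (`JetData.δ_pos`). -/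
theorem δ_pos (n : ℕ) :
    0 < (fun n : ℕ => if h : Odd n then (haveI : NeZero n := ⟨h.pos.ne'⟩;
        (JsB12CombSh0 (Lc := n) h N (combTablesAn1S2 n h (cΛ (Nat.log Lc n))) (cΛ (Nat.log Lc n)) (cB (Nat.log Lc n)) 0).δ) else 1) n :=
  pin_δ_pos (fun n h => (haveI : NeZero n := ⟨h.pos.ne'⟩;
        (JsB12CombSh0 (Lc := n) h N (combTablesAn1S2 n h (cΛ (Nat.log Lc n))) (cΛ (Nat.log Lc n)) (cB (Nat.log Lc n)) 0).δ))
    (fun n h => by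
    haveI : NeZero n := ⟨h.pos.ne'⟩
    exact (JsB12CombSh0 (Lc := n) h N (combTablesAn1S2 n h (cΛ (Nat.log Lc n))) (cΛ (Nat.log Lc n)) (cB (Nat.log Lc n)) 0).δ_pos) n

end Summit.QuantumFields.BalabanUV.Beta.D1BFx.RoadCombPinAn1

end
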